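import Mathlib
import Summits.CriticalPhenomena.CardyFormulaZ2.Theorems.CardySelfRefinementGradientComparabilityStubJointCrossingNondegenerate
import Literature.Probability.Percolation.SelfRefinementMeasure
import HarnessLib

/-!
# Boundary value `c = 1` of the self-refinement model: sure crossings

Helper file for the stub `stub_boundaryValues` of the line `Sketch` (crux
`stmt-CriticalPhenomena-10269`, `…Theses.CardySelfRefinement.GradientComparability`).

## Mathematics

Under `M_k(ρ, 1)` (`k = 2, 3`, any `ρ`) the own coin of every interior (non-axial) edge has bias
`projIcc 1 = 1`, so almost surely every interior edge of `ℤ²` is open: every row `y = r` with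
`¬ k ∣ r` and every column `x = r` with `¬ k ∣ r` is entirely open.  Among two consecutive
integers one is not a multiple of `k ≥ 2`, so every translated `8n × n` rectangle of the drawing
`v ↦ √2 v - w` with `n ≥ 3` contains a fully open row joining its two short sides, and every
`n × 8n` rectangle a fully open column (`embRectCrossing_of_rows`, `embTBCrossing_of_cols`).
Feeding these sure box crossings into the tube of each quad (`exists_tube_events`, file
`…StubJointCrossingNondegenerateTube`/`…Nondegenerate`) shows that, for every mesh `η` below a
threshold depending only on the quad family, every quad `F i` is crossed inside the drawn open
edges, i.e. (closure semantics on lattice configurations,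
`mem_z2QuadConfig_iff_exists_isCrossing`) the joint crossing event `A` holds almost surely:
`P k m F η ρ 1 = 1` (`P_one_eq_one_eventually`).
-/

noncomputable section

namespace Summit.CriticalPhenomena.CardyFormulaZ2.Theorems.CardySelfRefinement

open scoped Topology
open Filter Set MeasureTheory
open Literature.Probability.LatticeModels Literature.Probability.Percolation
open Literature.Probability.Percolation.QuadCrossing
open Summit.CriticalPhenomena.CardyFormulaZ2.Theses.CardySelfRefinement

/-! ## The route's model is the tree's self-refinement measure -/

/-- `M k ρ c` is, term for term, the tree's `selfRefinementMeasure k ρ c`. -/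
theorem M_eq_selfRefinementMeasure (k : ℕ) (ρ c : ℝ) : M k ρ c = selfRefinementMeasure k ρ c :=
  rfl

/-- `cfg k` is the tree's `refinementConfig k`. -/
theorem cfg_eq_refinementConfig (k : ℕ) : cfg k = refinementConfig k := rfl

/-- `prm k ρ c` is the tree's `refinementParam k ρ c`. -/
theorem prm_eq_refinementParam (k : ℕ) (ρ c : ℝ) : prm k ρ c = refinementParam k ρ c := rfl

/-- `P` is the coin probability of the pull-back of the cylinder `Aloc` (`η ≠ 0`). -/
theorem P_eq_real_preimage (k m : ℕ) (F : Fin m → Quad (univ : Set ℂ)) {η : ℝ} (hη : η ≠ 0)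
    (ρ c : ℝ) :
    P k m F η ρ c = (prodBernoulli (refinementParam k ρ c)).real (cfg k ⁻¹' Aloc m F η) := by
  rw [P_eq_real_Aloc, M_eq_selfRefinementMeasure, selfRefinementMeasure_real_apply k ρ c
    (measurableSet_Aloc m F hη)]
  rfl

/-- On lattice configurations, membership of the configuration in `Aloc` is membership in `A`. -/
theorem cfg_mem_Aloc_iff (k m : ℕ) (F : Fin m → Quad (univ : Set ℂ)) (η : ℝ)
    (S : Set (Site 2 × Fin 2 × Fin 3)) : cfg k S ∈ Aloc m F η ↔ cfg k S ∈ A m F η := by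
  have hN : cfg k S ∈ nnSupport := cfg_subset_edgeSet k S
  have h := congrArg (cfg k S ∈ ·) (A_inter_nnSupport_eq m F η)
  simp only [mem_inter_iff, hN, and_true, eq_iff_iff] at h
  exact h.symm

/-- **The crossing criterion** on lattice configurations: `Q` is crossed at mesh `η > 0` in the
closure semantics of `configOf` iff some crossing of `Q` lies inside the open edges drawn at
mesh `η√2`. -/
theorem mem_configOf_iff_exists_isCrossing {η : ℝ} (hη : 0 < η) {ω : BondConfig (Site 2)}
    (hω : ω ⊆ (zdGraph 2).edgeSet) (Q : Quad (univ : Set ℂ)) :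
    Q ∈ configOf squareLatticeEmbedding.z η univ ω ↔
      ∃ K, Q.IsCrossing K ∧ K ⊆ openEdgeUnion (η * Real.sqrt 2) ω := by
  have hδ : 0 < η * Real.sqrt 2 := by positivity
  have e : configOf squareLatticeEmbedding.z η univ ω = z2QuadConfig univ (η * Real.sqrt 2) ω := by
    rw [configOf_squareLatticeEmbedding]
    simp only [z2QuadConfig, inter_eq_left.mpr hω]
  rw [show (Q ∈ configOf squareLatticeEmbedding.z η univ ω ↔
      Q ∈ z2QuadConfig univ (η * Real.sqrt 2) ω) from by rw [e]]
  exact mem_z2QuadConfig_iff_exists_isCrossing hδ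

/-! ## At `c = 1` every interior edge is almost surely open -/

/-- At `c = 1` the own coins of interior edges are almost surely all on. -/
theorem ae_forall_interior_mem (k : ℕ) (ρ : ℝ) :
    ∀ᵐ S ∂prodBernoulli (refinementParam k ρ 1),
      ∀ e : Site 2 × Fin 2, ¬ IsAxialEdge k e → (e.1, e.2, (0 : Fin 3)) ∈ S := by
  have h : ∀ e : Site 2 × Fin 2, ∀ᵐ S ∂prodBernoulli (refinementParam k ρ 1),
      ¬ IsAxialEdge k e → (e.1, e.2, (0 : Fin 3)) ∈ S := by
    intro e
    by_cases hax : IsAxialEdge k e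
    · exact ae_of_all _ fun _ h => absurd hax h
    · have h1 : refinementParam k ρ 1 (e.1, e.2, 0) = 1 := by
        rw [refinementParam_apply_zero_of_not_isAxialEdge _ _ hax, projIcc_unitInterval_one]
      filter_upwards [prodBernoulli_ae_mem _ h1] with S hS _ using hS
  exact ae_all_iff.2 h

/-- With all interior own coins on, every interior edge is open. -/
theorem mem_cfg_of_interior {k : ℕ} {S : Set (Site 2 × Fin 2 × Fin 3)}
    (hS : ∀ e : Site 2 × Fin 2, ¬ IsAxialEdge k e → (e.1, e.2, (0 : Fin 3)) ∈ S)
    (v : Site 2) (d : Fin 2) (hvd : ¬ IsAxialEdge k (v, d)) :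
    s(v, v + (if d = 0 then ![1, 0] else ![0, 1])) ∈ cfg k S := by
  refine ⟨v, d, rfl, ?_⟩
  have hax : ¬ ax k (v, d) := hvd
  simp only [opn, hax, if_false]
  exact hS (v, d) hvd

/-- With all interior own coins on, every horizontal edge of a row `r` with `¬ k ∣ r` is open. -/
theorem row_mem_cfg_of_interior {k : ℕ} {S : Set (Site 2 × Fin 2 × Fin 3)}
    (hS : ∀ e : Site 2 × Fin 2, ¬ IsAxialEdge k e → (e.1, e.2, (0 : Fin 3)) ∈ S)
    (x r : ℤ) (hr : ¬ (k : ℤ) ∣ r) : s((![x, r] : Site 2), ![x + 1, r]) ∈ cfg k S := by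
  have h := mem_cfg_of_interior hS ![x, r] 0 (by simpa using hr)
  have e : (![x, r] : Site 2) + ![1, 0] = ![x + 1, r] := by
    ext i; fin_cases i <;> simp
  simpa [e] using h

/-- With all interior own coins on, every vertical edge of a column `x` with `¬ k ∣ x` is open. -/
theorem col_mem_cfg_of_interior {k : ℕ} {S : Set (Site 2 × Fin 2 × Fin 3)}
    (hS : ∀ e : Site 2 × Fin 2, ¬ IsAxialEdge k e → (e.1, e.2, (0 : Fin 3)) ∈ S)
    (x y : ℤ) (hx : ¬ (k : ℤ) ∣ x) : s((![x, y] : Site 2), ![x, y + 1]) ∈ cfg k S := by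
  have h := mem_cfg_of_interior hS ![x, y] 1 (by simpa using hx)
  have e : (![x, y] : Site 2) + ![0, 1] = ![x, y + 1] := by
    ext i; fin_cases i <;> simp
  simpa [e] using h

/-! ## Straight open runs and sure box crossings -/

/-- An open horizontal run joins its ends inside any set containing its sites. -/
theorem openConnIn_of_row {ω : BondConfig (Site 2)} {T : Set (Site 2)} {a r : ℤ} {n : ℕ}
    (hopen : ∀ j : ℕ, j < n → s((![a + j, r] : Site 2), ![a + j + 1, r]) ∈ ω)
    (hT : ∀ j : ℕ, j ≤ n → (![a + j, r] : Site 2) ∈ T) :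
    ω ∈ openConnIn T ![a, r] ![a + n, r] := by
  induction n with
  | zero => simpa using (openConnIn_refl (hT 0 le_rfl) : ω ∈ openConnIn T ![a + (0 : ℕ), r] _)
  | succ n ih =>
    have h1 := ih (fun j hj => hopen j (Nat.lt_succ_of_lt hj)) fun j hj => hT j (Nat.le_succ_of_le hj)
    have hne : (![a + n, r] : Site 2) ≠ ![a + n + 1, r] := fun h => by
      have := congrFun h 0; simp at this
    have hT' : (![a + n + 1, r] : Site 2) ∈ T := by
      have := hT (n + 1) le_rfl
      push_cast at this
      rwa [← add_assoc] at this
    have h2 : ω ∈ openConnIn T ![a + n, r] ![a + n + 1, r] :=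
      openConnIn_of_adj (hT n (Nat.le_succ n)) hT' (hopen n (Nat.lt_succ_self n)) hne
    simpa [add_assoc] using PlanarDuality.openConnIn_trans h1 h2

/-- An open vertical run joins its ends inside any set containing its sites. -/
theorem openConnIn_of_col {ω : BondConfig (Site 2)} {T : Set (Site 2)} {x a : ℤ} {n : ℕ}
    (hopen : ∀ j : ℕ, j < n → s((![x, a + j] : Site 2), ![x, a + j + 1]) ∈ ω)
    (hT : ∀ j : ℕ, j ≤ n → (![x, a + j] : Site 2) ∈ T) :
    ω ∈ openConnIn T ![x, a] ![x, a + n] := by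
  induction n with
  | zero => simpa using (openConnIn_refl (hT 0 le_rfl) : ω ∈ openConnIn T ![x, a + (0 : ℕ)] _)
  | succ n ih =>
    have h1 := ih (fun j hj => hopen j (Nat.lt_succ_of_lt hj)) fun j hj => hT j (Nat.le_succ_of_le hj)
    have hne : (![x, a + n] : Site 2) ≠ ![x, a + n + 1] := fun h => by
      have := congrFun h 1; simp at this
    have hT' : (![x, a + n + 1] : Site 2) ∈ T := by
      have := hT (n + 1) le_rfl
      push_cast at this
      rwa [← add_assoc] at this
    have h2 : ω ∈ openConnIn T ![x, a + n] ![x, a + n + 1] :=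
      openConnIn_of_adj (hT n (Nat.le_succ n)) hT' (hopen n (Nat.lt_succ_self n)) hne
    simpa [add_assoc] using PlanarDuality.openConnIn_trans h1 h2

/-- Among two consecutive integers one is not a multiple of `k ≥ 2`. -/
theorem exists_not_dvd_consecutive {k : ℕ} (hk : 2 ≤ k) (r₀ : ℤ) :
    ∃ r : ℤ, ¬ (k : ℤ) ∣ r ∧ r₀ ≤ r ∧ r ≤ r₀ + 1 := by
  by_cases h : (k : ℤ) ∣ r₀
  · refine ⟨r₀ + 1, fun h' => ?_, by omega, le_rfl⟩
    have h1 : (k : ℤ) ∣ 1 := by simpa using (Int.dvd_sub h' h)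
    have : (k : ℤ) ≤ 1 := Int.le_of_dvd one_pos h1
    omega
  · exact ⟨r₀, h, le_rfl, by omega⟩

/-- A lattice line of the drawing `v ↦ √2 v - w` inside a band of width `n ≥ 3` starting at
`o`, not on the coarse lattice: some integer `r` with `¬ k ∣ r` and `0 ≤ √2 r - o ≤ n`. -/
theorem exists_line_in_band {k : ℕ} (hk : 2 ≤ k) (o : ℝ) {n : ℕ} (hn : 3 ≤ n) :
    ∃ r : ℤ, ¬ (k : ℤ) ∣ r ∧ 0 ≤ Real.sqrt 2 * r - o ∧ Real.sqrt 2 * r - o ≤ n := by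
  have hs : 0 < Real.sqrt 2 := Real.sqrt_pos.2 (by norm_num)
  have hs' : Real.sqrt 2 < 3 / 2 := by rw [Real.sqrt_lt' (by norm_num)]; norm_num
  have hn' : (3 : ℝ) ≤ n := by exact_mod_cast hn
  obtain ⟨r, hr, h1, h2⟩ := exists_not_dvd_consecutive hk ⌈o / Real.sqrt 2⌉
  have hc1 := Int.le_ceil (o / Real.sqrt 2)
  have hc2 : ((⌈o / Real.sqrt 2⌉ : ℤ) : ℝ) - 1 < o / Real.sqrt 2 := by
    linarith [Int.ceil_lt_add_one (o / Real.sqrt 2)]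
  rw [div_le_iff₀ hs] at hc1
  rw [lt_div_iff₀ hs] at hc2
  have e1 : ((⌈o / Real.sqrt 2⌉ : ℤ) : ℝ) ≤ r := by exact_mod_cast h1
  have e2 : (r : ℝ) ≤ (⌈o / Real.sqrt 2⌉ : ℤ) + 1 := by exact_mod_cast h2
  refine ⟨r, hr, ?_, ?_⟩ <;> nlinarith

/-- **Sure horizontal crossings.** If every horizontal edge of every row `r` with `¬ k ∣ r` is
open (`k ≥ 2`), every translated `8n × n` rectangle with `n ≥ 3` is crossed horizontally. -/
theorem embRectCrossing_of_rows {k : ℕ} (hk : 2 ≤ k) {ω : BondConfig (Site 2)}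
    (hω : ∀ x r : ℤ, ¬ (k : ℤ) ∣ r → s((![x, r] : Site 2), ![x + 1, r]) ∈ ω)
    (w : ℂ) {n : ℕ} (hn : 3 ≤ n) :
    ω ∈ embRectCrossing (fun v => squareLatticeEmbedding.z v - w) (8 * n) n := by
  have hs : 0 < Real.sqrt 2 := Real.sqrt_pos.2 (by norm_num)
  have hs' : Real.sqrt 2 < 3 / 2 := by rw [Real.sqrt_lt' (by norm_num)]; norm_num
  obtain ⟨r, hr, hr0, hr1⟩ := exists_line_in_band hk w.im hn
  set a : ℤ := ⌊w.re / Real.sqrt 2⌋ with ha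
  set b : ℤ := ⌈(w.re + 8 * n) / Real.sqrt 2⌉ with hb
  have ha1 := Int.floor_le (w.re / Real.sqrt 2)
  have ha2 := Int.lt_floor_add_one (w.re / Real.sqrt 2)
  have hb1 := Int.le_ceil ((w.re + 8 * n) / Real.sqrt 2)
  have hb2 : ((⌈(w.re + 8 * n) / Real.sqrt 2⌉ : ℤ) : ℝ) - 1 < (w.re + 8 * n) / Real.sqrt 2 := by
    linarith [Int.ceil_lt_add_one ((w.re + 8 * n) / Real.sqrt 2)]
  rw [le_div_iff₀ hs] at ha1
  rw [div_lt_iff₀ hs] at ha2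
  rw [div_le_iff₀ hs] at hb1
  rw [lt_div_iff₀ hs] at hb2
  have hn0 : (0 : ℝ) ≤ n := by positivity
  have hab : a ≤ b := by
    have : (a : ℝ) ≤ b := by nlinarith
    exact_mod_cast this
  obtain ⟨N, hN⟩ : ∃ N : ℕ, b = a + N := ⟨(b - a).toNat, by omega⟩
  refine ⟨![a, r], ?_, ![b, r], ?_, ?_⟩
  · simp only [mem_setOf_eq, squareLatticeEmbedding_z_sub_re, Matrix.cons_val_zero]
    linarith
  · simp only [mem_setOf_eq, squareLatticeEmbedding_z_sub_re, Matrix.cons_val_zero]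
    linarith
  · rw [hN]
    refine openConnIn_of_row (fun j _ => hω _ _ hr) fun j hj => ?_
    have hj' : ((a : ℝ) + j) ≤ b := by
      have : a + (j : ℤ) ≤ b := by omega
      exact_mod_cast this
    have hj0 : (0 : ℝ) ≤ j := by positivity
    simp only [mem_setOf_eq, squareLatticeEmbedding_z_sub_re, squareLatticeEmbedding_z_sub_im,
      Matrix.cons_val_zero, Matrix.cons_val_one, mem_Icc]
    push_cast
    refine ⟨⟨?_, ?_⟩, hr0, hr1⟩ <;> nlinarith

/-- **Sure vertical crossings.** If every vertical edge of every column `x` with `¬ k ∣ x` is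
open (`k ≥ 2`), every translated `n × 8n` rectangle with `n ≥ 3` is crossed vertically. -/
theorem embTBCrossing_of_cols {k : ℕ} (hk : 2 ≤ k) {ω : BondConfig (Site 2)}
    (hω : ∀ x y : ℤ, ¬ (k : ℤ) ∣ x → s((![x, y] : Site 2), ![x, y + 1]) ∈ ω)
    (w : ℂ) {n : ℕ} (hn : 3 ≤ n) :
    ω ∈ embTBCrossing (fun v => squareLatticeEmbedding.z v - w) n (8 * n) := by
  have hs : 0 < Real.sqrt 2 := Real.sqrt_pos.2 (by norm_num)
  have hs' : Real.sqrt 2 < 3 / 2 := by rw [Real.sqrt_lt' (by norm_num)]; norm_num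
  obtain ⟨x, hx, hx0, hx1⟩ := exists_line_in_band hk w.re hn
  set a : ℤ := ⌊w.im / Real.sqrt 2⌋ with ha
  set b : ℤ := ⌈(w.im + 8 * n) / Real.sqrt 2⌉ with hb
  have ha1 := Int.floor_le (w.im / Real.sqrt 2)
  have ha2 := Int.lt_floor_add_one (w.im / Real.sqrt 2)
  have hb1 := Int.le_ceil ((w.im + 8 * n) / Real.sqrt 2)
  have hb2 : ((⌈(w.im + 8 * n) / Real.sqrt 2⌉ : ℤ) : ℝ) - 1 < (w.im + 8 * n) / Real.sqrt 2 := by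
    linarith [Int.ceil_lt_add_one ((w.im + 8 * n) / Real.sqrt 2)]
  rw [le_div_iff₀ hs] at ha1
  rw [div_lt_iff₀ hs] at ha2
  rw [div_le_iff₀ hs] at hb1
  rw [lt_div_iff₀ hs] at hb2
  have hn0 : (0 : ℝ) ≤ n := by positivity
  have hab : a ≤ b := by
    have : (a : ℝ) ≤ b := by nlinarith
    exact_mod_cast this
  obtain ⟨N, hN⟩ : ∃ N : ℕ, b = a + N := ⟨(b - a).toNat, by omega⟩
  refine ⟨![x, a], ?_, ![x, b], ?_, ?_⟩
  · simp only [mem_setOf_eq, squareLatticeEmbedding_z_sub_im, Matrix.cons_val_one,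
      Matrix.cons_val_fin_one]
    linarith
  · simp only [mem_setOf_eq, squareLatticeEmbedding_z_sub_im, Matrix.cons_val_one,
      Matrix.cons_val_fin_one]
    linarith
  · rw [hN]
    refine openConnIn_of_col (fun j _ => hω _ _ hx) fun j hj => ?_
    have hj' : ((a : ℝ) + j) ≤ b := by
      have : a + (j : ℤ) ≤ b := by omega
      exact_mod_cast this
    have hj0 : (0 : ℝ) ≤ j := by positivity
    simp only [mem_setOf_eq, squareLatticeEmbedding_z_sub_re, squareLatticeEmbedding_z_sub_im,
      Matrix.cons_val_zero, Matrix.cons_val_one, mem_Icc]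
    push_cast
    refine ⟨⟨hx0, hx1⟩, ?_, ?_⟩ <;> nlinarith

/-! ## `P k m F η ρ 1 = 1` for all small meshes -/

/-- **Boundary value `c = 1`.**  For `k = 2, 3`, every `ρ` and every mesh `η` below a threshold
depending only on the quad family, the joint crossing probability under `M_k(ρ, 1)` is `1`:
almost surely all interior edges are open, the rows and columns off the coarse lattice are
entirely open, so the tube rectangles of every quad are crossed and every quad is crossed. -/
theorem P_one_eq_one_eventually {k : ℕ} (hk : k = 2 ∨ k = 3) (m : ℕ)
    (F : Fin m → Quad (univ : Set ℂ)) :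
    ∀ᶠ η in 𝓝[>] (0 : ℝ), ∀ ρ : ℝ, P k m F η ρ 1 = 1 := by
  have hk2 : 2 ≤ k := by rcases hk with rfl | rfl <;> norm_num
  choose N Pt s hs hev using fun i => exists_tube_events (F i)
  have hsmall : ∀ᶠ η in 𝓝[>] (0 : ℝ), ∀ i, η < s i / 6 :=
    eventually_all.2 fun i => (gt_mem_nhds (by linarith [hs i] : (0 : ℝ) < s i / 6)).filter_mono
      nhdsWithin_le_nhds
  filter_upwards [hsmall, self_mem_nhdsWithin] with η hη hη0 ρ
  have hη0 : 0 < η := hη0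
  rw [P_eq_real_preimage k m F hη0.ne']
  -- the pull-back of `Aloc` has full coin measure
  have hae : ∀ᵐ S ∂prodBernoulli (refinementParam k ρ 1), S ∈ cfg k ⁻¹' Aloc m F η := by
    filter_upwards [ae_forall_interior_mem k ρ] with S hS
    rw [mem_preimage, cfg_mem_Aloc_iff]
    intro i
    rw [mem_configOf_iff_exists_isCrossing hη0 (cfg_subset_edgeSet k S)]
    have h6 : 6 * η ≤ s i := by linarith [hη i]
    have hfl := Nat.lt_floor_add_one (s i / η)
    have hfl' := Nat.floor_le (div_nonneg (hs i).le hη0.le)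
    rw [div_lt_iff₀ hη0] at hfl
    rw [le_div_iff₀ hη0] at hfl'
    have hn1 : s i - η < η * ⌊s i / η⌋₊ := by linarith
    have hn2 : η * ⌊s i / η⌋₊ ≤ s i := by linarith
    have hn3 : 3 ≤ ⌊s i / η⌋₊ := by
      have h : (3 : ℝ) < ⌊s i / η⌋₊ := by
        by_contra hcon
        push Not at hcon
        nlinarith [hη i]
      exact_mod_cast h.le
    obtain ⟨K, hK, hKO⟩ := hev i η hη0 h6 _ hn1 hn2 0 (by simp; positivity) (by simp; positivity)
      (cfg k S) (cfg_subset_edgeSet k S) fun j _ =>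
        ⟨embRectCrossing_of_rows hk2 (fun x r hr => row_mem_cfg_of_interior hS x r hr) _ hn3,
          embTBCrossing_of_cols hk2 (fun x y hx => col_mem_cfg_of_interior hS x y hx) _ hn3⟩
    exact ⟨K, hK, fun z hz => by simpa using hKO z hz⟩
  have h1 : prodBernoulli (refinementParam k ρ 1) (cfg k ⁻¹' Aloc m F η) = 1 := by
    rw [← prob_compl_eq_zero_iff ((measurable_cfg k) (measurableSet_Aloc m F hη0.ne'))]
    exact ae_iff.1 hae
  rw [measureReal_def, h1, ENNReal.toReal_one]

end Summit.CriticalPhenomena.CardyFormulaZ2.Theorems.CardySelfRefinement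

end
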